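import Summits.AtomisticToContinuum.FouriersLaw.Theses.PuiseuxTransferLedger
import Summits.AtomisticToContinuum.FouriersLaw.Theorems.FourierGreenKuboFourierFiniteResponseOfUnique

/-!
# `ExponentiallyAffineResistance` (stmt-AtomisticToContinuum-12115): hardness reductions

Support file for the BY-PRODUCT item `ExponentiallyAffineResistance` of route
`PuiseuxTransferLedger` (NOT a hypothesis of its deciding theorem `closes`; planner tag
`[difficulty: open-problem]`). The item asserts, for the pinned anharmonic chain, Fourier's law WITH
contact resistance and exponentially small finite-size corrections:
`|(N-1)/D_N - ((N-1) r + ρ)| ≤ C θ^N`, `r > 0`, `θ < 1`.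

This file records, sorry-free, how strong that statement is relative to the rest of the route:

* `tendsto_of_exponentiallyAffine` — pure real analysis: an exponentially (indeed any `o(N)`-)
  affine resistance sequence with slope `r > 0` has conductances `D_N → 1/r` (Lean's junk
  conventions `x/0 = 0`, `0⁻¹ = 0` make no positivity hypothesis on `D_N` necessary).
* `nonBallistic_of_exponentiallyAffineResistance` — the by-product IMPLIES the route's rank-3 crux
  `NonBallistic` outright (same hypothesis prefix).
* `fouriersLaw_of_exponentiallyAffineResistance` — the by-product ALONE implies the sub-problem
  Statement `FouriersLaw`: existence of the steady states (`pinnedChain_exists_isSteadyState`),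
  their uniqueness (`NessUnique_holds`) and the existence of the finite-`N` response coefficients
  (`FourierGreenKubo.finiteResponse_of_unique`, stmt-0717) are all proved in the tree, and the
  by-product supplies `D_N → 1/r > 0`: an alternative one-line assembly of the route, and the formal
  reason the item is summit-hard (an open problem), not a routine support statement.
-/

namespace Summit.AtomisticToContinuum.FouriersLaw.Theorems

open Filter Topology
open Summit.AtomisticToContinuum.FouriersLaw.Theses.PuiseuxTransferLedger
open Literature.MathematicalPhysics.KineticTheory.HeatConduction

/-- `N - 1 → ∞` along the naturals (cast to `ℝ`). [folklore] -/
theorem tendsto_natCast_sub_one_atTop :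
    Tendsto (fun N : ℕ => ((N : ℝ) - 1)) atTop atTop := by
  have h := tendsto_atTop_add_const_right atTop (-1 : ℝ) (tendsto_natCast_atTop_atTop (R := ℝ))
  refine h.congr fun N => ?_
  ring

/-- **Affine resistance forces a finite positive conductivity** (pure real analysis). If a real
sequence `D` satisfies `|(N-1)/D_N - ((N-1) r + ρ)| ≤ C θ^N` for all `N ≥ 2` with `r > 0` and
`0 ≤ θ < 1`, then `D_N → 1/r`. No sign hypothesis on `D_N` is needed: with Lean's conventions
`(N-1)/D_N/(N-1) = (D_N)⁻¹` identically for `N ≥ 2`, and `x ↦ x⁻¹` is continuous at `r ≠ 0`.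
[folklore] -/
theorem tendsto_of_exponentiallyAffine {D : ℕ → ℝ} {r ρ θ C : ℝ} (hr : 0 < r)
    (hθ0 : 0 ≤ θ) (hθ1 : θ < 1)
    (h : ∀ N : ℕ, 2 ≤ N → |((N : ℝ) - 1) / D N - (((N : ℝ) - 1) * r + ρ)| ≤ C * θ ^ N) :
    Tendsto D atTop (𝓝 (1 / r)) := by
  -- the inverse conductances converge to the slope `r`
  have hinv : Tendsto (fun N : ℕ => (D N)⁻¹) atTop (𝓝 r) := by
    have hK : Tendsto (fun N : ℕ => (|ρ| + |C|) * ((N : ℝ) - 1)⁻¹) atTop (𝓝 0) := by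
      simpa using tendsto_natCast_sub_one_atTop.inv_tendsto_atTop.const_mul (|ρ| + |C|)
    have hbound : ∀ᶠ N : ℕ in atTop, ‖(D N)⁻¹ - r‖ ≤ (|ρ| + |C|) * ((N : ℝ) - 1)⁻¹ := by
      filter_upwards [eventually_ge_atTop 2] with N hN
      have hN2 : (2 : ℝ) ≤ (N : ℝ) := by exact_mod_cast hN
      have hNpos : (0 : ℝ) < (N : ℝ) - 1 := by linarith
      have hN0 : (N : ℝ) - 1 ≠ 0 := ne_of_gt hNpos
      have hCθ : C * θ ^ N ≤ |C| :=
        calc C * θ ^ N ≤ |C| * θ ^ N :=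
              mul_le_mul_of_nonneg_right (le_abs_self C) (pow_nonneg hθ0 N)
          _ ≤ |C| * 1 := mul_le_mul_of_nonneg_left (pow_le_one₀ hθ0 hθ1.le) (abs_nonneg C)
          _ = |C| := mul_one _
      have hkey : ((N : ℝ) - 1) / D N / ((N : ℝ) - 1) = (D N)⁻¹ := by
        rw [div_div, mul_comm, ← div_div, div_self hN0, one_div]
      have hrepr : (D N)⁻¹ - r =
          (ρ + (((N : ℝ) - 1) / D N - (((N : ℝ) - 1) * r + ρ))) / ((N : ℝ) - 1) := by
        rw [← hkey]
        generalize ((N : ℝ) - 1) / D N = X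
        field_simp
        ring
      rw [Real.norm_eq_abs, hrepr, abs_div, abs_of_pos hNpos, div_eq_mul_inv]
      refine mul_le_mul_of_nonneg_right ?_ (inv_nonneg.mpr hNpos.le)
      exact (abs_add_le _ _).trans (add_le_add le_rfl ((h N hN).trans hCθ))
    have h0 : Tendsto (fun N : ℕ => (D N)⁻¹ - r) atTop (𝓝 0) := squeeze_zero_norm' hbound hK
    simpa using h0.add_const r
  simpa [one_div] using hinv.inv₀ hr.ne'

/-- **The by-product implies the crux `NonBallistic`.** Along any steady-state family with
response coefficients `D_N`, exponentially affine resistance gives `D_N → 1/r`, so the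
conductance `D_N/(N-1)` is eventually below any `ε > 0`: `ExponentiallyAffineResistance` is at least
as strong as the route's rank-3 crux (stmt-AtomisticToContinuum-9127). [folklore] -/
theorem nonBallistic_of_exponentiallyAffineResistance (hE : ExponentiallyAffineResistance) :
    NonBallistic := by
  intro ω₂ lam β γ hω hl hβ hγ huniq μ hμ T hT D hD ε hε N₀
  obtain ⟨r, ρ, θ, C, hr, hθ0, hθ1, hb⟩ := hE ω₂ lam β γ hω hl hβ hγ huniq μ hμ T hT D hD
  have hlim := tendsto_of_exponentiallyAffine hr hθ0 hθ1 hb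
  have h1 : ∀ᶠ N : ℕ in atTop, D N ≤ 1 / r + 1 :=
    hlim.eventually (eventually_le_nhds (lt_add_one (1 / r)))
  have h2 : ∀ᶠ N : ℕ in atTop, 1 / r + 1 ≤ ε * ((N : ℝ) - 1) :=
    (tendsto_natCast_sub_one_atTop.const_mul_atTop hε).eventually_ge_atTop _
  obtain ⟨N, hN, hN₀⟩ := ((h1.and h2).and (eventually_ge_atTop N₀)).exists
  exact ⟨N, hN₀, hN.1.trans hN.2⟩

/-- **The by-product is summit-hard.** `ExponentiallyAffineResistance` implies the sub-problem
Statement `FouriersLaw` outright: clause (i) is the proved existence theorem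
`pinnedChain_exists_isSteadyState` plus the proved `NessUnique_holds`; for clause (ii) take the
canonical family of unique steady states, its response coefficients `D_N` (they exist:
`FourierGreenKubo.finiteResponse_of_unique`, the proved item stmt-AtomisticToContinuum-0717), the
data `(r, ρ, θ, C)` of the by-product, `κ(T) := 1/r`, and transfer the difference quotients to any
other steady-state family by uniqueness near `δ = 0` (the transfer step of the route's `closes`).
[folklore] -/
theorem fouriersLaw_of_exponentiallyAffineResistance (hE : ExponentiallyAffineResistance) :
    _root_.FouriersLaw := by
  intro ω₂ lam β γ hω hl hβ hγ
  have huniq := NessUnique_holds ω₂ lam β γ hω hl hβ hγ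
  have hFR := FourierGreenKubo.finiteResponse_of_unique ω₂ lam β γ hω hl hβ hγ huniq
  refine ⟨?_, ?_⟩
  · -- clause (i): existence (Literature theorem) + uniqueness (proved item)
    intro N T_L T_R hL hR
    obtain ⟨μ, hμ⟩ := pinnedChain_exists_isSteadyState hω hl hβ hγ N hL hR
    exact ⟨μ, hμ, fun ν hν => huniq N T_L T_R hL hR ν μ hν hμ⟩
  · classical
    -- the canonical family of (unique) steady states, junk `0` at non-positive temperatures
    let μ₀ : (N : ℕ) → ℝ → ℝ → MeasureTheory.Measure (PhaseSpace N) := fun N T_L T_R =>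
      if h : 0 < T_L ∧ 0 < T_R then
        Classical.choose (pinnedChain_exists_isSteadyState hω hl hβ hγ N h.1 h.2)
      else 0
    have hμ₀ : ∀ (N : ℕ) (T_L T_R : ℝ), 0 < T_L → 0 < T_R →
        (pinnedChain ω₂ lam β γ).IsSteadyState N T_L T_R (μ₀ N T_L T_R) := by
      intro N T_L T_R hL hR
      have h : 0 < T_L ∧ 0 < T_R := ⟨hL, hR⟩
      simp only [μ₀, dif_pos h]
      exact Classical.choose_spec (pinnedChain_exists_isSteadyState hω hl hβ hγ N hL hR)
    -- for every `T > 0` the canonical response coefficients converge to a positive limit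
    have key : ∀ T : ℝ, 0 < T → ∃ k : ℝ, 0 < k ∧ ∃ D : ℕ → ℝ,
        (∀ N : ℕ, Tendsto
          (fun δ : ℝ => (pinnedChain ω₂ lam β γ).totalCurrent (μ₀ N (T + δ / 2) (T - δ / 2)) / δ)
          (𝓝[≠] 0) (𝓝 (D N))) ∧
        Tendsto D atTop (𝓝 k) := by
      intro T hT
      have hD' := hFR μ₀ hμ₀ T hT
      choose D hD using hD'
      obtain ⟨r, ρ, θ, C, hr, hθ0, hθ1, hb⟩ :=
        hE ω₂ lam β γ hω hl hβ hγ huniq μ₀ hμ₀ T hT D hD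
      exact ⟨1 / r, by positivity, D, hD, tendsto_of_exponentiallyAffine hr hθ0 hθ1 hb⟩
    choose! κ hκ using key
    refine ⟨κ, fun T hT => (hκ T hT).1, ?_⟩
    intro μ hμ T hT
    obtain ⟨D, hD, hlim⟩ := (hκ T hT).2
    refine ⟨D, fun N => ?_, hlim⟩
    -- transfer to the given family: same states near `δ = 0` by uniqueness
    have hnear : ∀ᶠ δ in 𝓝 (0 : ℝ), 0 < T + δ / 2 ∧ 0 < T - δ / 2 := by
      have hmem : Set.Ioo (-(2 * T)) (2 * T) ∈ 𝓝 (0 : ℝ) :=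
        Ioo_mem_nhds (by linarith) (by linarith)
      filter_upwards [hmem] with δ hδ
      obtain ⟨h1, h2⟩ := hδ
      constructor <;> linarith
    refine (hD N).congr' ?_
    filter_upwards [eventually_nhdsWithin_of_eventually_nhds hnear] with δ hδ
    rw [huniq N _ _ hδ.1 hδ.2 (μ₀ N (T + δ / 2) (T - δ / 2)) (μ N (T + δ / 2) (T - δ / 2))
      (hμ₀ N _ _ hδ.1 hδ.2) (hμ N _ _ hδ.1 hδ.2)]

end Summit.AtomisticToContinuum.FouriersLaw.Theorems
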